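import Literature.IUT.HodgeTheaters.PiAvatarRankOneExponent
import Mathlib.Algebra.Group.Subgroup.Pointwise
import Mathlib.Algebra.Torsor.Basic

/-!
# [IUTchI] Def 6.1 (v): automorphisms of `𝒟^{⊚±}` act on the cusps UNIT-EQUIVARIANTLY (Y-classes of decomposition groups)

S. Mochizuki, *Inter-universal Teichmüller theory I*, kurims manuscript (May 2020), §6 Definition 6.1 (v) p. 158:
"`Aut_±(𝒟^{⊚±})` … acts transitively on the cusps of `X_K`", "`Aut_csp(𝒟^{⊚±}) ⊆ Aut_±(𝒟^{⊚±})` … the subgroup of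
automorphisms that fix the cusps of `X_K`", "natural outer isomorphisms `Aut_K(X_K) ⥲ Aut_±(𝒟^{⊚±})/Aut_csp(𝒟^{⊚±}) ⥲
𝔽_l^{⋊±}`"; §1 p. 37 (cusps of `X̲` and their decomposition groups `D_x ⊆ Π_X̲`) ([IUTchI] Def 6.1 (v) p.158)
[claim: Mochizuki2012, status: disputed] (D-0012 claim key, series status DISPUTED — this file is GROUP THEORY;
nothing of the series is asserted and no side is taken on [IUTchIII] Cor. 3.12).

## What (KIT-INSTANCE row D13-P3-v, follow-up; the bridge between `PiAvatarRankOneExponent` / `PiAvatarFlStarCharacter`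
(the exponent `u` of a normalising element `n` on `X/Y = Gal(X̲_K/X_K)`) and `LabelsPlusMinusUnitEquivariant` §2 (maps
of cusp torsors with `f (q +ᵥ s) = (u·q) +ᵥ f s`))

In the Π-avatar (abc-iut-L5-t4 `PiAvatarOrbitCategory`/`PiAvatarBinding`; abc-iut-L5-t1 `CuspGalois`: cusps carry
chosen decomposition groups `dec x ≤ Y = Π_{X̲_K}`, distinct cusps have non-`Y`-conjugate groups, `g ∈ Π` acts by
"`g·D_x·g⁻¹` is `Y`-conjugate to `D_{g·x}`") an element `a ∈ A` ACTS ON THE CUSPS THROUGH `Y`-CLASSES when a map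
`σ : C → C` satisfies `∀ x, ∃ t ∈ Y, (t a)·dec x·(t a)⁻¹ = dec (σ x)` — an "`a`-datum".  Def-free lemmas:

* `cuspDatum_unique` — an `a`-datum is unique (separation of `Y`-classes); `cuspDatum_one`/`_of_mem` — the identity is
  the datum of `1` and of every `y ∈ Y`; `cuspDatum_comp` — for `a ∈ N_A(Y)` the composite of an `a`-datum and a
  `b`-datum is an `ab`-datum; `cuspDatum_pow` — powers; `cuspDatum_inv_apply` / `cuspDatum_apply_inv` — data of
  `a`, `a⁻¹` are mutually inverse BIJECTIONS;
* `cuspDatum_conj_comm` — **the compatibility**: for `n, g ∈ N_A(Y)` with data `σ_n, σ_g, σ_{ngn⁻¹}`: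
  `σ_n (σ_g x) = σ_{ngn⁻¹} (σ_n x)`;
* `cuspDatum_conj_of_pow_mem` / `cuspDatum_conj_eq_iterate` — with the EXPONENT of `PiAvatarRankOneExponent`
  (`(g^u)⁻¹ (n g n⁻¹) ∈ Y`): `σ_g^[u]` is an `(ngn⁻¹)`-datum, hence `σ_n ∘ σ_g = σ_g^[u] ∘ σ_n`;
* `cuspDatum_vadd` — TORSOR FORM: if `ℤ/l` acts on the cusps with `(1 : ZMod l) +ᵥ x = σ_{g₀} x` for a `g₀`-datum
  (`g₀ ∈ X`, the generator of `Gal(X̲_K/X_K)`), then `σ_n (q +ᵥ x) = (u·q) +ᵥ σ_n x` for every `q` — exactly the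
  hypothesis `hf` of `FlPMTorsor.mem_autPM_iff_mk_eq_one` / `unitEquivariant_eq_one_of_forall_eq` (p422171), with
  `u = conjExponent n` (p423880): `gLab_range` / `autCsp_le` at the instance.

Proof-only (0 definitions, no instance, no notation, no `Prop` fact). typed ≠ proved elsewhere.
-/

namespace Literature.IUT.HodgeTheaters

open scoped Pointwise

namespace CuspDatum

variable {A : Type*} [Group A] {Y : Subgroup A} {C : Type*} {dec : C → Subgroup A}

/-- An `a`-datum is UNIQUE when distinct cusps have non-`Y`-conjugate decomposition groups (abc-iut-L5-t1
`CuspGalois.eq_of_conj`). ([IUTchI] §1 p.37) [claim: Mochizuki2012, status: disputed] -/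
theorem cuspDatum_unique
    (hsep : ∀ (x y : C) (t : A), t ∈ Y → MulAut.conj t • dec x = dec y → x = y)
    {a : A} {σ σ' : C → C}
    (hσ : ∀ x, ∃ t ∈ Y, MulAut.conj (t * a) • dec x = dec (σ x))
    (hσ' : ∀ x, ∃ t ∈ Y, MulAut.conj (t * a) • dec x = dec (σ' x)) (x : C) : σ x = σ' x := by
  obtain ⟨t, ht, h⟩ := hσ x
  obtain ⟨t', ht', h'⟩ := hσ' x
  apply hsep (σ x) (σ' x) (t' * t⁻¹) (Y.mul_mem ht' (Y.inv_mem ht))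
  rw [← h, ← h', smul_smul, ← map_mul]
  congr 2
  group

/-- The identity is a `1`-datum. ([IUTchI] §1 p.37) [claim: Mochizuki2012, status: disputed] -/
theorem cuspDatum_one (x : C) : ∃ t ∈ Y, MulAut.conj (t * 1) • dec x = dec (id x) :=
  ⟨1, Y.one_mem, by rw [mul_one, map_one, one_smul]; rfl⟩

/-- The identity is a `y`-datum for every `y ∈ Y` (so `Y = Π_{X̲_K}` acts trivially on its own cusps).
([IUTchI] §1 p.37) [claim: Mochizuki2012, status: disputed] -/
theorem cuspDatum_of_mem {y : A} (hy : y ∈ Y) (x : C) : ∃ t ∈ Y, MulAut.conj (t * y) • dec x = dec (id x) :=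
  ⟨y⁻¹, Y.inv_mem hy, by rw [inv_mul_cancel, map_one, one_smul]; rfl⟩

/-- **Composition**: for `a` normalising `Y`, an `a`-datum after a `b`-datum is an `ab`-datum.
([IUTchI] §1 p.37) [claim: Mochizuki2012, status: disputed] -/
theorem cuspDatum_comp {a b : A} (ha : a ∈ Subgroup.normalizer (Y : Set A)) {σ τ : C → C}
    (hσ : ∀ x, ∃ t ∈ Y, MulAut.conj (t * a) • dec x = dec (σ x))
    (hτ : ∀ x, ∃ t ∈ Y, MulAut.conj (t * b) • dec x = dec (τ x)) (x : C) :
    ∃ t ∈ Y, MulAut.conj (t * (a * b)) • dec x = dec (σ (τ x)) := by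
  obtain ⟨t₂, ht₂, h₂⟩ := hτ x
  obtain ⟨t₁, ht₁, h₁⟩ := hσ (τ x)
  refine ⟨t₁ * (a * t₂ * a⁻¹), Y.mul_mem ht₁ ((Subgroup.mem_normalizer_iff.mp ha t₂).mp ht₂), ?_⟩
  rw [← h₁, ← h₂, smul_smul, ← map_mul]
  congr 2
  group

/-- **The compatibility square** ([IUTchI] Def 6.1 (v): automorphisms of `𝒟^{⊚±}` normalise `Gal(X̲_K/X_K)` and act
on the cusps accordingly): for `n, g` normalising `Y` with data `σ_n, σ_g, σ_{ngn⁻¹}`,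
`σ_n (σ_g x) = σ_{ngn⁻¹} (σ_n x)`. ([IUTchI] Def 6.1 (v) p.158) [claim: Mochizuki2012, status: disputed] -/
theorem cuspDatum_conj_comm
    (hsep : ∀ (x y : C) (t : A), t ∈ Y → MulAut.conj t • dec x = dec y → x = y)
    {n g : A} (hn : n ∈ Subgroup.normalizer (Y : Set A)) (hg : g ∈ Subgroup.normalizer (Y : Set A))
    {σn σg σc : C → C}
    (hσn : ∀ x, ∃ t ∈ Y, MulAut.conj (t * n) • dec x = dec (σn x))
    (hσg : ∀ x, ∃ t ∈ Y, MulAut.conj (t * g) • dec x = dec (σg x))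
    (hσc : ∀ x, ∃ t ∈ Y, MulAut.conj (t * (n * g * n⁻¹)) • dec x = dec (σc x)) (x : C) :
    σn (σg x) = σc (σn x) := by
  have hc : n * g * n⁻¹ ∈ Subgroup.normalizer (Y : Set A) :=
    Subgroup.mul_mem _ (Subgroup.mul_mem _ hn hg) (Subgroup.inv_mem _ hn)
  -- both composites are data for `n g = (n g n⁻¹) n`
  have h1 := cuspDatum_comp (σ := σn) (τ := σg) hn hσn hσg
  have h2 : ∀ x, ∃ t ∈ Y, MulAut.conj (t * (n * g)) • dec x = dec (σc (σn x)) := fun x => by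
    obtain ⟨t, ht, h⟩ := cuspDatum_comp (σ := σc) (τ := σn) hc hσc hσn x
    exact ⟨t, ht, by rwa [show n * g * n⁻¹ * n = n * g by group] at h⟩
  exact cuspDatum_unique hsep h1 h2 x

/-- **Powers**: the `k`-th iterate of a `g`-datum is a `g^k`-datum (for `g` normalising `Y`).
([IUTchI] §1 p.37) [claim: Mochizuki2012, status: disputed] -/
theorem cuspDatum_pow {g : A} (hg : g ∈ Subgroup.normalizer (Y : Set A)) {σ : C → C}
    (hσ : ∀ x, ∃ t ∈ Y, MulAut.conj (t * g) • dec x = dec (σ x)) :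
    ∀ (k : ℕ) (x : C), ∃ t ∈ Y, MulAut.conj (t * g ^ k) • dec x = dec (σ^[k] x) := by
  intro k
  induction k with
  | zero => intro x; simpa using cuspDatum_one (Y := Y) (dec := dec) x
  | succ k ih =>
    intro x
    obtain ⟨t, ht, h⟩ := cuspDatum_comp (σ := σ) (τ := σ^[k]) hg hσ ih x
    refine ⟨t, ht, ?_⟩
    rw [Function.iterate_succ_apply', ← h, pow_succ']

/-- A datum for `a` is a datum for `a y`, `y ∈ Y` (data only depend on the coset `aY`; with `cuspDatum_unique`:
`Y`-cosets act) . ([IUTchI] §1 p.37) [claim: Mochizuki2012, status: disputed] -/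
theorem cuspDatum_mul_of_mem {a y : A} (ha : a ∈ Subgroup.normalizer (Y : Set A)) (hy : y ∈ Y) {σ : C → C}
    (hσ : ∀ x, ∃ t ∈ Y, MulAut.conj (t * a) • dec x = dec (σ x)) (x : C) :
    ∃ t ∈ Y, MulAut.conj (t * (a * y)) • dec x = dec (σ x) := by
  have h := cuspDatum_comp (σ := σ) (τ := id) ha hσ (fun x => cuspDatum_of_mem hy x) x
  exact h

/-- **Inverses**: for `a` normalising `Y`, an `a⁻¹`-datum is a left inverse of an `a`-datum (so data of
normalising elements are BIJECTIONS of the cusp set — the permutations `gLabMap` of the binding).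
([IUTchI] Def 6.1 (v) p.158) [claim: Mochizuki2012, status: disputed] -/
theorem cuspDatum_inv_apply
    (hsep : ∀ (x y : C) (t : A), t ∈ Y → MulAut.conj t • dec x = dec y → x = y)
    {a : A} (ha : a ∈ Subgroup.normalizer (Y : Set A)) {σ τ : C → C}
    (hσ : ∀ x, ∃ t ∈ Y, MulAut.conj (t * a) • dec x = dec (σ x))
    (hτ : ∀ x, ∃ t ∈ Y, MulAut.conj (t * a⁻¹) • dec x = dec (τ x)) (x : C) : τ (σ x) = x := by
  have ha' : a⁻¹ ∈ Subgroup.normalizer (Y : Set A) := Subgroup.inv_mem _ ha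
  have h := cuspDatum_comp (σ := τ) (τ := σ) ha' hτ hσ
  simp only [inv_mul_cancel] at h
  exact cuspDatum_unique hsep h (fun y => by simpa using cuspDatum_one (Y := Y) (dec := dec) y) x

/-- … and a right inverse. ([IUTchI] Def 6.1 (v) p.158) [claim: Mochizuki2012, status: disputed] -/
theorem cuspDatum_apply_inv
    (hsep : ∀ (x y : C) (t : A), t ∈ Y → MulAut.conj t • dec x = dec y → x = y)
    {a : A} (ha : a ∈ Subgroup.normalizer (Y : Set A)) {σ τ : C → C}
    (hσ : ∀ x, ∃ t ∈ Y, MulAut.conj (t * a) • dec x = dec (σ x))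
    (hτ : ∀ x, ∃ t ∈ Y, MulAut.conj (t * a⁻¹) • dec x = dec (τ x)) (x : C) : σ (τ x) = x := by
  have h := cuspDatum_comp (σ := σ) (τ := τ) ha hσ hτ
  simp only [mul_inv_cancel] at h
  exact cuspDatum_unique hsep h (fun y => by simpa using cuspDatum_one (Y := Y) (dec := dec) y) x

/-- **Conjugates act by the exponent**: if `n g n⁻¹ ≡ g^u (mod Y)` (the membership form of
`PiAvatarRankOneExponent.exists_unique_conj_pow_mem` / `conjExponent_spec`), then the `u`-th iterate of a `g`-datum
is an `(n g n⁻¹)`-datum, hence (uniqueness) `σ_{ngn⁻¹} = σ_g^u`.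
([IUTchI] Def 6.1 (v) p.158) [claim: Mochizuki2012, status: disputed] -/
theorem cuspDatum_conj_of_pow_mem {n g : A} (hg : g ∈ Subgroup.normalizer (Y : Set A)) {u : ℕ}
    (hu : (g ^ u)⁻¹ * (n * g * n⁻¹) ∈ Y) {σ : C → C}
    (hσ : ∀ x, ∃ t ∈ Y, MulAut.conj (t * g) • dec x = dec (σ x)) (x : C) :
    ∃ t ∈ Y, MulAut.conj (t * (n * g * n⁻¹)) • dec x = dec (σ^[u] x) := by
  have hgu : g ^ u ∈ Subgroup.normalizer (Y : Set A) := Subgroup.pow_mem _ hg u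
  have h := cuspDatum_mul_of_mem hgu hu (cuspDatum_pow hg hσ u) x
  rwa [mul_inv_cancel_left] at h

/-- **The automorphism `n` commutes with `Gal(X̲_K/X_K)` up to the exponent**: `σ_n (σ_g x) = σ_g^[u] (σ_n x)` whenever
`n g n⁻¹ ≡ g^u (mod Y)`. ([IUTchI] Def 6.1 (v) p.158) [claim: Mochizuki2012, status: disputed] -/
theorem cuspDatum_conj_eq_iterate
    (hsep : ∀ (x y : C) (t : A), t ∈ Y → MulAut.conj t • dec x = dec y → x = y)
    {n g : A} (hn : n ∈ Subgroup.normalizer (Y : Set A)) (hg : g ∈ Subgroup.normalizer (Y : Set A))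
    {u : ℕ} (hu : (g ^ u)⁻¹ * (n * g * n⁻¹) ∈ Y) {σn σg : C → C}
    (hσn : ∀ x, ∃ t ∈ Y, MulAut.conj (t * n) • dec x = dec (σn x))
    (hσg : ∀ x, ∃ t ∈ Y, MulAut.conj (t * g) • dec x = dec (σg x)) (x : C) :
    σn (σg x) = σg^[u] (σn x) :=
  cuspDatum_conj_comm hsep hn hg hσn hσg (cuspDatum_conj_of_pow_mem hg hu hσg) x

/-! ### Torsor form: `σ_n (q +ᵥ x) = (u·q) +ᵥ σ_n x` -/

/-- If `ℤ/l` acts on the cusps so that `(1 : ZMod l) +ᵥ x = σ_{g₀} x` for a map `σ_{g₀}` (a `g₀`-datum, `g₀` a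
generator of `Gal(X̲_K/X_K)`), then `(k : ZMod l) +ᵥ x` is the `k`-th iterate of `σ_{g₀}`.
([IUTchI] Def 6.1 (iii) p.157) [claim: Mochizuki2012, status: disputed] -/
theorem natCast_vadd_eq_iterate {l : ℕ} [AddAction (ZMod l) C] {σ : C → C}
    (h1 : ∀ x : C, (1 : ZMod l) +ᵥ x = σ x) (k : ℕ) (x : C) : ((k : ZMod l) +ᵥ x) = σ^[k] x := by
  induction k generalizing x with
  | zero => simp
  | succ k ih => rw [Nat.cast_succ, add_comm, add_vadd, h1, ih, Function.iterate_succ_apply']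

/-- Hence `q +ᵥ x = σ_{g₀}^[q.val] x` and `σ_{g₀}^[l] = id`.
([IUTchI] Def 6.1 (iii) p.157) [claim: Mochizuki2012, status: disputed] -/
theorem vadd_eq_iterate {l : ℕ} [NeZero l] [AddAction (ZMod l) C] {σ : C → C}
    (h1 : ∀ x : C, (1 : ZMod l) +ᵥ x = σ x) (q : ZMod l) (x : C) : q +ᵥ x = σ^[q.val] x := by
  rw [← natCast_vadd_eq_iterate h1 q.val x, ZMod.natCast_zmod_val]

/-- The generating datum is `l`-periodic: `σ_{g₀}^[l] x = x` (`(l : ZMod l) = 0`).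
([IUTchI] Def 6.1 (iii) p.157) [claim: Mochizuki2012, status: disputed] -/
theorem iterate_card_eq_self {l : ℕ} [AddAction (ZMod l) C] {σ : C → C}
    (h1 : ∀ x : C, (1 : ZMod l) +ᵥ x = σ x) (x : C) : σ^[l] x = x := by
  rw [← natCast_vadd_eq_iterate h1 l x, ZMod.natCast_self, zero_vadd]

/-- Iterates only depend on the exponent modulo `l`. ([IUTchI] Def 6.1 (iii) p.157) [claim: Mochizuki2012, status: disputed] -/
theorem iterate_eq_iterate_mod {l : ℕ} [AddAction (ZMod l) C] {σ : C → C}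
    (h1 : ∀ x : C, (1 : ZMod l) +ᵥ x = σ x) (m : ℕ) (x : C) : σ^[m] x = σ^[m % l] x := by
  have hper : ∀ (k : ℕ) (y : C), σ^[l * k] y = y := by
    intro k
    induction k with
    | zero => intro y; simp
    | succ k ih => intro y; rw [Nat.mul_succ, Function.iterate_add_apply, iterate_card_eq_self h1, ih]
  conv_lhs => rw [← Nat.mod_add_div m l, Function.iterate_add_apply, hper]

/-- **TORSOR FORM of the compatibility** (the hypothesis `hf` of `FlPMTorsor.mem_autPM_iff_mk_eq_one` /
`unitEquivariant_eq_one_of_forall_eq`, p422171): if `ℤ/l` acts on the cusps through a `g₀`-datum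
(`(1 : ZMod l) +ᵥ x = σ_{g₀} x`, `g₀ ∈ X` a generator of `Gal(X̲_K/X_K) = X/Y`) and `n g₀ n⁻¹ ≡ g₀^u (mod Y)` for the unit
`u` (= `conjExponent n`, p423880), then an `n`-datum `σ_n` satisfies `σ_n (q +ᵥ x) = (u·q) +ᵥ σ_n x`.
([IUTchI] Def 6.1 (v) p.158) [claim: Mochizuki2012, status: disputed] -/
theorem cuspDatum_vadd {l : ℕ} [NeZero l] [AddAction (ZMod l) C]
    (hsep : ∀ (x y : C) (t : A), t ∈ Y → MulAut.conj t • dec x = dec y → x = y)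
    {n g₀ : A} (hn : n ∈ Subgroup.normalizer (Y : Set A)) (hg₀ : g₀ ∈ Subgroup.normalizer (Y : Set A))
    {u : (ZMod l)ˣ} (hu : (g₀ ^ (u : ZMod l).val)⁻¹ * (n * g₀ * n⁻¹) ∈ Y) {σn σ₀ : C → C}
    (hσn : ∀ x, ∃ t ∈ Y, MulAut.conj (t * n) • dec x = dec (σn x))
    (hσ₀ : ∀ x, ∃ t ∈ Y, MulAut.conj (t * g₀) • dec x = dec (σ₀ x))
    (h1 : ∀ x : C, (1 : ZMod l) +ᵥ x = σ₀ x) (q : ZMod l) (x : C) :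
    σn (q +ᵥ x) = ((u : ZMod l) * q) +ᵥ σn x := by
  rw [vadd_eq_iterate h1, vadd_eq_iterate h1]
  -- one step: `σ_n ∘ σ₀ = σ₀^[u] ∘ σ_n`
  have step : ∀ y : C, σn (σ₀ y) = σ₀^[(u : ZMod l).val] (σn y) :=
    cuspDatum_conj_eq_iterate hsep hn hg₀ hu hσn hσ₀
  -- iterate it: `σ_n ∘ σ₀^[k] = σ₀^[u k] ∘ σ_n`
  have key : ∀ (k : ℕ) (y : C), σn (σ₀^[k] y) = σ₀^[(u : ZMod l).val * k] (σn y) := by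
    intro k
    induction k with
    | zero => intro y; simp
    | succ k ih =>
      intro y
      rw [Function.iterate_succ_apply, ih, step, ← Function.iterate_add_apply, mul_add_one]
  rw [key, iterate_eq_iterate_mod h1 ((u : ZMod l).val * q.val), ZMod.val_mul]

end CuspDatum

end Literature.IUT.HodgeTheaters
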